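import Summits.BirchSwinnertonDyer.Rank1Residual.X4.KuriharaAdditiveCertificateTwist
import Summits.BirchSwinnertonDyer.Rank1Residual.X4.KimDefectAdditiveLevelLowering
import HarnessLib

/-!
# The `ord_p ∏ c ≤ e + 1` closure of a TWIST-GOOD row from an ADDITIVE (two-prime `τ`-system) certificate computed on its twist: K87 (transport) composed with K86 (the one-factor socket at `α = e = e₁ + e₂`) (cell `b2b-bsdres`, seat additive-p4 gen 31, line V52; the SPREAD row 298980j1)

HONEST FRAMING (cell `b2b-bsdres`, verbatim in every file): the goal of the cell is to DELETE the
COMBINATION-SHAPED residual classes for ALL analytic-rank `≤ 1` curves over `ℚ` — "full BSD formula for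
every rank `≤ 1` curve in class `C`" assembled STRICTLY from published theorems — so that the rank-`≤ 1`
remainder becomes exactly the CONSTRUCTION-SHAPED classes, which are TYPED (missing-input Props), NOT
attempted; this is not "finishing BSD". This file: research route on the CONSTRUCTION-shaped class X4;
X4 stays CONSTRUCTION-SHAPED; labels unchanged; nothing booked; no Literature fact minted; the `p ≥ 3`
statement is CONDITIONAL on the announced Kim 2025 clause; THEOREMS ONLY; `#print axioms` standard.

## What is here

ONE-STATEMENT ENDs for a twist-good row `W = V ⊗ χ` with TWO defect primes `ℓ₁, ℓ₂` (the SPREAD rows of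
the `ord_p ∏ c ≥ 3` residue, beyond the reach of every single-prime or eigen certificate): the inputs are
(a) the ℚ-level twist identity of the plus symbol of `D.f` with a `V`-side symbol function `σ` and ONE
`p`-integral constant `c₀` (tree theorems `ModularForms.exists_rat_forall_ratPlusSymbol_charTwist_eq[_of_odd]`
+ period bookkeeping), (b) the `V`-side ADDITIVE mod-`p^e` data for `\overline{σ}` — families
`Dα, Dβ, τ` with the Hecke-derivative relations of eigenvalues `a_q(V)`, the `τ`-identities with signs
`w₁, w₂`, and the decomposition (the per-pair joint `τ`-certificate computed by instrument E9b at the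
levels `N_V`, `N_V/ℓ_i`, `N_V/(ℓ₁ℓ₂)` — EVIDENCE), (c) the twist relation `a_q(W) = χ(q) a_q(V)` at the
Kolyvagin primes and `w_i χ(ℓ_i) = 1`, (d) `ord_p ∏_v c_v(W) ≤ e + 1`, `#Ш_an(W)` a `p`-unit, and the
published inputs of the socket. Then `BSD(W, p)`: at `p ≥ 5` from PUBLISHED inputs (`…_of_five_le`), at
`p ≥ 3` modulo Kim 2025 (`…_of_kim2025_OPEN`; the shape of the SPREAD row 298980j1 at `p = 3`: `T = 3`,
primes `5, 11` with `e = 1, 1`, `−3`-twist of conductor `33 220`). PARITY (gen 31 audit): `σ` here must have the parity of `χ` — for an ODD character (`D < 0`, e.g. `χ_{−3}`) `σ` is the MINUS symbol of `f_V` (tree: `exists_rat_forall_ratPlusSymbol_charTwist_eq_of_odd`), so the `V`-side data must be computed on the MINUS modular-symbol space of `V`; a certificate found on `V`'s PLUS space is one for `W`'s MINUS symbol and is NOT an input of this theorem. (The gen-30 E9b run on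
298980j1's twist — joint `τ`-system found and unique at `k = 2` — was on the PLUS space, the wrong
parity here; the minus-space run is the cell's instrument record, prereg P-SIGN.) Nothing booked; per
pair; X4 CONSTRUCTION-SHAPED.

References: Kim 2026 [Kim2022StructureSelmer] Thm. 1.9 (6), Conj. 1.10; Kim 2025 [Kim2025RefinedTNC]
Thm. 1.1 (PREPRINT, reason only); Mazur–Tate–Teitelbaum 1986 §I.8 [MazurTateTeitelbaum1986Invent];
Shimura 1971 Prop. 3.64 [Shimura1971]; Silverman AEC X.4.14 [SilvermanAEC2009]; Miller 2011 Def. 1.1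
[Miller2011LMS].
-/

noncomputable section

open scoped Classical MatrixGroups ModularForm

open CongruenceSubgroup WeierstrassCurve Literature.NumberTheory.EllipticCurves
  Literature.NumberTheory.EllipticCurves.ModularForms
  Literature.NumberTheory.EllipticCurves.Rank1Residual
  Literature.NumberTheory.EllipticCurves.Rank1Residual.Typed
  Summit.BirchSwinnertonDyer.Rank1Residual.LevelLowering
  Summit.BirchSwinnertonDyer.Rank1Residual.Additive

open Literature.NumberTheory.DiophantineGeometry.Dioph (ratModP)

namespace Summit.BirchSwinnertonDyer.Rank1Residual.X4

variable (W V : WeierstrassCurve ℚ) [W.IsElliptic] [W.IsGloballyMinimal] [V.IsGloballyMinimal]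
  (p : ℕ) [hp : Fact p.Prime]

/-- **`BSD(W,p)` on a twist-good `ord_p ∏ c ≤ e + 1` unit row at `p ≥ 5`, from an ADDITIVE certificate
computed on the twist `V`** (K87 `plusSymbolLevelLowersAdditivelyModAt_of_ratTwist` ∘ K86
`bsdp_of_plusSymbolLevelLowersAdditivelyModAt_of_tamagawa_le_succ_of_shaAn_unit_of_five_le`): PUBLISHED
inputs (Kim (6) `hKimk`/`hE67c`, Cassels–Tate, GZK, modularity), analytic rank `0`, `ρ̄_{W,p}` onto,
conductor-level datum `D` of `W` with `p ∤ c_D` and the period transfer, `#Ш_an = q'` a `p`-unit; the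
ℚ-level twist identity `[r]⁺_{D.f} = c₀ ∑_u ε(u) σ(r + u/m)` with `p ∤ den c₀`, `p`-integral `σ`,
`ε` reducing to `χ : ℤ/m →* ℤ/p^e`; the `V`-side additive mod-`p^e` data (`Dα, Dβ, τ`, eigenvalues
`a_q(V)` at the Kolyvagin primes of `(W,p)`, signs `w₁, w₂`), `ℓ₁, ℓ₂ ∣ N_W` invertible mod `m` with
`χ(ℓ_i)² = 1`, `w_i χ(ℓ_i) = 1`, the twist relation `a_q(W) = χ(q) a_q(V)`; and
`ord_p ∏_v c_v(W) ≤ e + 1`. Per pair; nothing booked. [cite: Kim2022StructureSelmer, Thm. 1.9 (6) and Conj. 1.10 (PDF p. 8)]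
[cite: MazurTateTeitelbaum1986Invent, §I.8] [cite: SilvermanAEC2009, Thm. X.4.14] [cite: Miller2011LMS, §1 and Def. 1.1] -/
theorem bsdp_of_ratTwist_levelLowersAdditivelyModAt_of_tamagawa_le_succ_of_shaAn_unit_of_five_le
    (hKimk : Kim2026.rankZero_le_padicValNat_sha_of_kuriharaNumber_ne_zero)
    (hE67c : Kim2026.rankZero_padicValNat_sha_add_le_of_forall_pow_dvd_kuriharaNumber_cyclicLevel)
    (hCT : exists_casselsTate_pairing (K := ℚ))
    (hGZK : rank_eq_analyticRank_of_analyticRank_le_one) (hmod : hasEntireLFunction_rat)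
    (hp5 : 5 ≤ p) (hr : W.analyticRank = 0) (hsurj : W.HasSurjectiveModNGaloisRep p)
    {N : ℕ} [NeZero N] (D : ModularParametrizationData W N) (hN : W.conductorNorm ℤ = N)
    (hc : ¬ (p : ℤ) ∣ D.maninConstant)
    (hper : ∃ u : ℚ, ‖(u : ℚ_[p])‖ = 1 ∧ W.realPeriodRat = u * plusPeriod D.f)
    {q' : ℚ} (hq' : shaAn W = (q' : ℂ)) (hv : padicValRat p q' = 0)
    {e : ℕ} {m : ℕ} [NeZero m] (χ : ZMod m →* ZMod (p ^ e)) (ε : ZMod m → ℤ)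
    (hε : ∀ u : ZMod m, ((ε u : ℤ) : ZMod (p ^ e)) = χ u)
    (σ : ℚ → ℚ) (c₀ : ℚ) (hc₀ : ¬ p ∣ c₀.den) (hint : ∀ x : ℚ, ¬ p ∣ (σ x).den)
    (hsym : ∀ r : ℚ, ratPlusSymbol D.f r =
      c₀ * ∑ u : ZMod m, (ε u : ℚ) * σ (r + (u.val : ℚ) / m))
    {ℓ₁ ℓ₂ : ℕ} (Dα Dβ τ : Finset ℕ → ℚ → ZMod (p ^ e))
    (hpα : ∀ U, IsPeriodic (Dα U)) (hpβ : ∀ U, IsPeriodic (Dβ U)) (hpτ : ∀ U, IsPeriodic (τ U))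
    (hDα : ∀ (U : Finset ℕ) (q : ℕ), Kato.IsKolyvaginPrime W p 1 q → q ∉ U → ∀ r : ℚ,
      heckeTransform q (Dα U) r = (V.frobeniusTrace q : ZMod (p ^ e)) * Dα U r + Dα (insert q U) r)
    (hDβ : ∀ (U : Finset ℕ) (q : ℕ), Kato.IsKolyvaginPrime W p 1 q → q ∉ U → ∀ r : ℚ,
      heckeTransform q (Dβ U) r = (V.frobeniusTrace q : ZMod (p ^ e)) * Dβ U r + Dβ (insert q U) r)
    (hDτ : ∀ (U : Finset ℕ), U.Nonempty → ∀ (q : ℕ), Kato.IsKolyvaginPrime W p 1 q → q ∉ U →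
      ∀ r : ℚ, heckeTransform q (τ U) r =
        (V.frobeniusTrace q : ZMod (p ^ e)) * τ U r + τ (insert q U) r)
    {w₁ w₂ : ZMod (p ^ e)}
    (h1 : ∀ U : Finset ℕ, U.Nonempty → (∀ q ∈ U, Kato.IsKolyvaginPrime W p 1 q) →
      ∀ r : ℚ, Dα U r = τ U r - w₂ * τ U (ℓ₂ * r))
    (h2 : ∀ U : Finset ℕ, U.Nonempty → (∀ q ∈ U, Kato.IsKolyvaginPrime W p 1 q) →
      ∀ r : ℚ, Dβ U r = -(τ U r - w₁ * τ U (ℓ₁ * r)))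
    (hV : ∀ r : ℚ, ratModP (p ^ e) (σ r) =
      (Dα ∅ r - w₁ * Dα ∅ (ℓ₁ * r)) + (Dβ ∅ r - w₂ * Dβ ∅ (ℓ₂ * r)))
    (hℓ₁N : ℓ₁ ∣ W.conductorNorm ℤ) (hℓ₂N : ℓ₂ ∣ W.conductorNorm ℤ)
    (hℓ₁ : IsUnit ((ℓ₁ : ℕ) : ZMod m) ∧ χ ℓ₁ ^ 2 = 1 ∧ w₁ * χ ℓ₁ = 1)
    (hℓ₂ : IsUnit ((ℓ₂ : ℕ) : ZMod m) ∧ χ ℓ₂ ^ 2 = 1 ∧ w₂ * χ ℓ₂ = 1)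
    (hunit : ∀ q : ℕ, Kato.IsKolyvaginPrime W p 1 q → IsUnit ((q : ℕ) : ZMod m) ∧ χ q ^ 2 = 1)
    (haq : ∀ q : ℕ, Kato.IsKolyvaginPrime W p 1 q →
      (W.frobeniusTrace q : ZMod (p ^ e)) = χ q * V.frobeniusTrace q)
    (hce : padicValNat p W.tamagawaProduct ≤ e + 1) : BSDp W p :=
  bsdp_of_plusSymbolLevelLowersAdditivelyModAt_of_tamagawa_le_succ_of_shaAn_unit_of_five_le W p hKimk
    hE67c hCT hGZK hmod hp5 hr hsurj D hN hc hper hq' hv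
    (plusSymbolLevelLowersAdditivelyModAt_of_ratTwist W V χ ε hε D.f σ c₀ hc₀ hint hsym Dα Dβ τ hpα
      hpβ hpτ hDα hDβ hDτ h1 h2 hV hℓ₁ hℓ₂ hunit haq) hℓ₁N hℓ₂N hce

/-- **The `p ≥ 3` tower twin, CONDITIONAL on the announced Kim 2025 clause** (`hK25s`): `BSD(W,p)` on
a twist-good unit tower row with `ord_p ∏_v c_v(W) ≤ e + 1` from an ADDITIVE mod-`p^e` certificate
computed on the twist `V` IN THE PARITY OF `χ` (minus space for odd `χ_D`, `D < 0`) — the twist-good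
SPREAD rows of N11 (e.g. 298980j1 at `p = 3`, `T = 3`, primes `5, 11`, `−3`-twist of conductor
`33 220`; EVIDENCE per pair). Nothing booked. [claim: Kim2025RefinedTNC, status: under-review]
[cite: Kim2025RefinedTNC, Thm. 1.1 ("BSD") (ANNOUNCED, OPEN binder)] [cite: Kim2022StructureSelmer, Conj. 1.10 (PDF p. 8)]
[cite: MazurTateTeitelbaum1986Invent, §I.8] [cite: SilvermanAEC2009, Thm. X.4.14] -/
theorem bsdp_of_ratTwist_levelLowersAdditivelyModAt_of_tamagawa_le_succ_of_shaAn_unit_of_kim2025_OPEN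
    (hK25s : Kim2025.thm11_kimShaLength_of_integralPeriod_OPEN)
    (hCT : exists_casselsTate_pairing (K := ℚ))
    (hGZK : rank_eq_analyticRank_of_analyticRank_le_one) (hmod : hasEntireLFunction_rat)
    (hp3 : 3 ≤ p) (hr : W.analyticRank = 0) (htower : ∀ n : ℕ, W.HasSurjectiveModNGaloisRep (p ^ n : ℕ))
    {N : ℕ} [NeZero N] (D : ModularParametrizationData W N) (hN : W.conductorNorm ℤ = N)
    (hper : ∃ u : ℚ, ‖(u : ℚ_[p])‖ = 1 ∧ W.realPeriodRat = u * plusPeriod D.f)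
    {q' : ℚ} (hq' : shaAn W = (q' : ℂ)) (hv : padicValRat p q' = 0)
    {e : ℕ} {m : ℕ} [NeZero m] (χ : ZMod m →* ZMod (p ^ e)) (ε : ZMod m → ℤ)
    (hε : ∀ u : ZMod m, ((ε u : ℤ) : ZMod (p ^ e)) = χ u)
    (σ : ℚ → ℚ) (c₀ : ℚ) (hc₀ : ¬ p ∣ c₀.den) (hint : ∀ x : ℚ, ¬ p ∣ (σ x).den)
    (hsym : ∀ r : ℚ, ratPlusSymbol D.f r =
      c₀ * ∑ u : ZMod m, (ε u : ℚ) * σ (r + (u.val : ℚ) / m))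
    {ℓ₁ ℓ₂ : ℕ} (Dα Dβ τ : Finset ℕ → ℚ → ZMod (p ^ e))
    (hpα : ∀ U, IsPeriodic (Dα U)) (hpβ : ∀ U, IsPeriodic (Dβ U)) (hpτ : ∀ U, IsPeriodic (τ U))
    (hDα : ∀ (U : Finset ℕ) (q : ℕ), Kato.IsKolyvaginPrime W p 1 q → q ∉ U → ∀ r : ℚ,
      heckeTransform q (Dα U) r = (V.frobeniusTrace q : ZMod (p ^ e)) * Dα U r + Dα (insert q U) r)
    (hDβ : ∀ (U : Finset ℕ) (q : ℕ), Kato.IsKolyvaginPrime W p 1 q → q ∉ U → ∀ r : ℚ,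
      heckeTransform q (Dβ U) r = (V.frobeniusTrace q : ZMod (p ^ e)) * Dβ U r + Dβ (insert q U) r)
    (hDτ : ∀ (U : Finset ℕ), U.Nonempty → ∀ (q : ℕ), Kato.IsKolyvaginPrime W p 1 q → q ∉ U →
      ∀ r : ℚ, heckeTransform q (τ U) r =
        (V.frobeniusTrace q : ZMod (p ^ e)) * τ U r + τ (insert q U) r)
    {w₁ w₂ : ZMod (p ^ e)}
    (h1 : ∀ U : Finset ℕ, U.Nonempty → (∀ q ∈ U, Kato.IsKolyvaginPrime W p 1 q) →
      ∀ r : ℚ, Dα U r = τ U r - w₂ * τ U (ℓ₂ * r))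
    (h2 : ∀ U : Finset ℕ, U.Nonempty → (∀ q ∈ U, Kato.IsKolyvaginPrime W p 1 q) →
      ∀ r : ℚ, Dβ U r = -(τ U r - w₁ * τ U (ℓ₁ * r)))
    (hV : ∀ r : ℚ, ratModP (p ^ e) (σ r) =
      (Dα ∅ r - w₁ * Dα ∅ (ℓ₁ * r)) + (Dβ ∅ r - w₂ * Dβ ∅ (ℓ₂ * r)))
    (hℓ₁N : ℓ₁ ∣ W.conductorNorm ℤ) (hℓ₂N : ℓ₂ ∣ W.conductorNorm ℤ)
    (hℓ₁ : IsUnit ((ℓ₁ : ℕ) : ZMod m) ∧ χ ℓ₁ ^ 2 = 1 ∧ w₁ * χ ℓ₁ = 1)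
    (hℓ₂ : IsUnit ((ℓ₂ : ℕ) : ZMod m) ∧ χ ℓ₂ ^ 2 = 1 ∧ w₂ * χ ℓ₂ = 1)
    (hunit : ∀ q : ℕ, Kato.IsKolyvaginPrime W p 1 q → IsUnit ((q : ℕ) : ZMod m) ∧ χ q ^ 2 = 1)
    (haq : ∀ q : ℕ, Kato.IsKolyvaginPrime W p 1 q →
      (W.frobeniusTrace q : ZMod (p ^ e)) = χ q * V.frobeniusTrace q)
    (hce : padicValNat p W.tamagawaProduct ≤ e + 1) : BSDp W p :=
  bsdp_of_plusSymbolLevelLowersAdditivelyModAt_of_tamagawa_le_succ_of_shaAn_unit_of_kim2025_OPEN W p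
    hK25s hCT hGZK hmod hp3 hr htower D hN hper hq' hv
    (plusSymbolLevelLowersAdditivelyModAt_of_ratTwist W V χ ε hε D.f σ c₀ hc₀ hint hsym Dα Dβ τ hpα
      hpβ hpτ hDα hDβ hDτ h1 h2 hV hℓ₁ hℓ₂ hunit haq) hℓ₁N hℓ₂N hce

end Summit.BirchSwinnertonDyer.Rank1Residual.X4

end
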